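import Literature.NumberTheory.EllipticCurves.OpenImageMazurFrobeniusProofs
import Literature.NumberTheory.EllipticCurves.ModPImageTransvectionCriterionProofs
import HarnessLib

/-!
# BirchSwinnertonDyer — rank ≥ 2 observatory: A HYPOTHESIS-FREE FROBENIUS CERTIFICATE FOR `ρ̄_{E,p}` ONTO `GL₂(𝔽_p)` —
# one good prime `ℓ ≡ 1 (mod p)` with `a_ℓ ≡ 2 (mod p)` and `p² ∤ ℓ + 1 − a_ℓ` (a TRANSVECTION Frobenius), given `E[p]` irreducible

HONEST FRAMING: per-curve certified theorems and census instruments; no claim on BSD in rank ≥ 2.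

WHAT.  `hasSurjectiveModNGaloisRep_of_frobenius_transvection`: for an elliptic curve `E = W/ℚ` in global minimal form, a prime
`p` with `E[p]` irreducible, and ONE prime `ℓ` of good reduction with `p ∣ ℓ − 1`, `p ∣ a_ℓ − 2` and `p² ∤ ℓ + 1 − a_ℓ = #Ẽ(𝔽_ℓ)`,
the mod-`p` representation `ρ̄_{E,p} : Γ_ℚ → Aut(E[p]) ≅ GL₂(𝔽_p)` is ONTO.  The three congruences are decidable from the
Weierstrass coefficients (`a_ℓ` by point counting), so this is a per-curve CERTIFICATE; the companion table file
`…Rank3ModThreeImage` runs it at `p = 3` on every row of `rank3Table` inside the kernel.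
PROOF (all inputs are tree theorems; no named fact is granted).  Suppose `ρ̄` is not onto.  Let `v` be the place of `ℚ` at `ℓ`,
`σ₀ ∈ Γ_ℚ` the restriction of a local Frobenius (`exists_isArithFrobAt_localAbsIntegers`, `resGalOfEmb`) and
`f : E[p^∞] ↪ Ẽ_v(𝔽̄_ℓ)` the injective, `σ₀ ↦ Frob_ℓ`-equivariant reduction map (`exists_reduceTorsionHom`, Silverman VII.3.1).
Manin's relation `Frob² − a_ℓ·Frob + ℓ = 0` on `Ẽ_v(𝔽̄_ℓ)` (`frobenius_sq_sub_trace_smul_add_card_smul`, with `tr = a_ℓ` by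
`natCard_point_reduction_minimal_baseChange`) pulls back to `σ₀²P − a_ℓ σ₀P + ℓP = O` for every `P ∈ E[p^∞]` — exactly the
device of the tree's `Mazur1978.isogenyCharacter_sq_sub_frobeniusTrace_mul_add_eq_zero`, here WITHOUT an isogeny character.
(A) On `E[p]` (`ℓ ≡ 1`, `a_ℓ ≡ 2`): `(σ₀ − 1)² = 0`, so `x := σ₀y − y` is `σ₀`-fixed for every `y ∈ E[p]`.
(B) `σ₀ ≠ 1` on `E[p]`: otherwise take `P` of order `p²` (`[p]` is onto `E(ℚ̄)`, `zsmul_geomPoints_surjective_of_charZero`;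
a non-zero point of `E[p]` from the frame `exists_frame_galoisRepTorsion_rat`); `Q := σ₀P − P ∈ E[p]` is fixed, Manin gives
`(ℓ + 1 − a_ℓ)·P + (2 − a_ℓ)·Q = O`, i.e. `(ℓ + 1 − a_ℓ)·P = O`, so `p² ∣ ℓ + 1 − a_ℓ` — excluded.
(C) So `g := ρ̄(σ₀)` satisfies `(g − 1)² = 0`, `g ≠ 1`: `σ₀ⁿy = y + n(σ₀y − y)` gives `g^p = 1`, and `g` has order `p`
inside the image `G = ρ̄(Γ_ℚ) ≤ GL₂(𝔽_p)` (frame `exists_frame_galoisRepTorsion_rat`), so `p ∣ #G`.  But `G ≠ GL₂` (assumption),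
`det G = 𝔽_pˣ` (`exists_mem_map_range_det_eq`) and `G` fixes no line (`E[p]` irreducible,
`not_le_eigenvectorStabilizer_of_hasIrreducibleModPGaloisRep`), whence `p ∤ #G` by Serre's Prop. 15 (the tree's
`Serre1972.not_dvd_natCard_of_forall_not_le_eigenvectorStabilizer`: a subgroup of order divisible by `p` contains `SL₂(𝔽_p)` or
is Borel) — contradiction.  (`p ∣ ℓ − 1` is what makes `g` unipotent; without it `g` could be the scalar `λ` with `λ² = ℓ`.)
USE: row 66 of the observatory (`…Rank3ModThreeImage`): `p = 3`, irreducibility from row 60, `a_ℓ` by the kernel.  NOT CLAIMED: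
any converse (a surjective `ρ̄` does have such `ℓ` by Chebotarev, which the tree does not prove here), anything about BSD.
Sources: J.-P. Serre, Invent. Math. 15 (1972) §2.4 Prop. 15, §2.6–2.8; B. Mazur, Invent. Math. 44 (1978) §6 proof of Prop. 6.3;
J. H. Silverman, AEC (2009) V.2.3.1, VII.3.1.
-/

set_option linter.dupNamespace false
set_option autoImplicit false

noncomputable section

open scoped Classical
open NumberField IsDedekindDomain IsDedekindDomain.HeightOneSpectrum Rat.HeightOneSpectrum Field WeierstrassCurve
open Literature Literature.NumberTheory Literature.NumberTheory.EllipticCurves Literature.NumberTheory.GaloisRepresentations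
open Literature.NumberTheory.GaloisRepresentations.Serre1972 Matrix

namespace Summit.BirchSwinnertonDyer.BirchSwinnertonDyer.Rank2Observatory

/-- **Frobenius transvection certificate for `ρ̄_{E,p}` onto.**  Let `E = W/ℚ` be an elliptic curve in global minimal form and
`p` a prime with `E[p]` irreducible.  If some prime `ℓ` of good reduction has `p ∣ ℓ − 1`, `p ∣ a_ℓ − 2` and `p² ∤ ℓ + 1 − a_ℓ`
(so `ρ̄_{E,p}(Frob_ℓ)` is a transvection: characteristic polynomial `(X − 1)²`, not the identity since `E[p] ⊄ Ẽ(𝔽_ℓ)[p^∞]` of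
order prime to `p²`), then `ρ̄_{E,p} : Γ_ℚ → Aut(E[p])` is surjective.
[cite: Serre1972, §2.4 Prop. 15] [cite: Mazur1978, §6 Prop. 6.3 (1) and its proof (p. 153)] -/
theorem hasSurjectiveModNGaloisRep_of_frobenius_transvection (W : WeierstrassCurve ℚ) [W.IsElliptic]
    [W.IsGloballyMinimal] (p ℓ : ℕ) [Fact p.Prime] [Fact ℓ.Prime] (hirr : W.HasIrreducibleModPGaloisRep p)
    (hgoodℓ : W.HasGoodReductionAtPrime ℓ) (hℓ1 : (p : ℤ) ∣ (ℓ : ℤ) - 1)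
    (ha2 : (p : ℤ) ∣ W.frobeniusTrace ℓ - 2) (hp2 : ¬ (p : ℤ) ^ 2 ∣ (ℓ : ℤ) + 1 - W.frobeniusTrace ℓ) :
    W.HasSurjectiveModNGaloisRep p := by
  have hp : p.Prime := Fact.out
  have hℓ : ℓ.Prime := Fact.out
  haveI : NeZero p := ⟨hp.ne_zero⟩
  have hℓp : ℓ ≠ p := by
    rintro rfl
    have h1 : (ℓ : ℤ) ∣ (ℓ : ℤ) - ((ℓ : ℤ) - 1) := dvd_sub (dvd_refl _) hℓ1
    rw [sub_sub_cancel] at h1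
    have h1' := Int.eq_one_of_dvd_one (by positivity) h1
    exact hℓ.one_lt.ne' (by exact_mod_cast h1')
  by_contra hns
  -- Step 0: the place `v` of `ℚ` at `ℓ`; `ℓ ∈ v`, `p ∉ v`, good reduction at `v`
  set v : HeightOneSpectrum (𝓞 ℚ) := (primesEquiv (R := 𝓞 ℚ)).symm ⟨ℓ, hℓ⟩ with hvdef
  have hvℓ : (primesEquiv v : ℕ) = ℓ := by rw [hvdef, Equiv.apply_symm_apply]
  have hgen : ((primesEquiv v : ℕ) : 𝓞 ℚ) ∈ v.asIdeal := by
    have h := (Rat.HeightOneSpectrum.natGenerator_dvd_iff v).mp dvd_rfl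
    rwa [← map_natCast (Rat.IsIntegralClosure.intEquiv (𝓞 ℚ)), Ideal.apply_mem_of_equiv_iff] at h
  have hv : (ℓ : 𝓞 ℚ) ∈ v.asIdeal := hvℓ ▸ hgen
  have hpv : (p : 𝓞 ℚ) ∉ v.asIdeal := fun h ↦ by
    have h' := Ideal.mem_map_of_mem (Rat.IsIntegralClosure.intEquiv (𝓞 ℚ)) h
    rw [map_natCast] at h'
    have hdvd : (primesEquiv v : ℕ) ∣ p := (Rat.HeightOneSpectrum.natGenerator_dvd_iff v).mpr h'
    rw [hvℓ] at hdvd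
    exact hℓp ((Nat.prime_dvd_prime_iff_eq hℓ hp).mp hdvd)
  have hgood : W.HasGoodReductionAt v := (hasGoodReductionAtPrime_primesEquiv_iff_holds W v ℓ hvℓ).mp hgoodℓ
  -- the reduction `Ẽ_v / k`, an elliptic curve over the residue field `k` with `ℓ` elements, `tr = a_ℓ`
  set k := IsLocalRing.ResidueField (v.adicCompletionIntegers ℚ) with hk
  letI : Fintype k := Fintype.ofFinite k
  set Wt : WeierstrassCurve k := W.reductionAt v with hWt
  haveI : Wt.IsElliptic := isElliptic_reductionAt hgood
  have hcardk : Fintype.card k = ℓ := by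
    rw [← Nat.card_eq_fintype_card, natCard_residueField_adicCompletionIntegers v, hvℓ]
  have hcardWt : Nat.card Wt.toAffine.Point = W.reductionPointCount ℓ := by
    rw [← hvℓ]
    exact natCard_point_reduction_minimal_baseChange v W
  have htr : HasseManin.tr Wt = W.frobeniusTrace ℓ := by rw [HasseManin.tr, hcardk, hcardWt, frobeniusTrace]
  -- Step 1: a Frobenius `σ₀ ∈ Γ_ℚ` at `ℓ` and the reduction map on `p`-primary torsion
  obtain ⟨𝔐, h𝔐⟩ := v.localPrimesAbove_nonempty
  let ι : AlgebraicClosure ℚ →ₐ[ℚ] AlgebraicClosure (v.adicCompletion ℚ) := closureEmb (K := ℚ) (v.adicCompletion ℚ)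
  obtain ⟨σL, hσL⟩ := v.exists_isArithFrobAt_localAbsIntegers h𝔐
  obtain ⟨φk, hφk⟩ := exists_frobenius_absoluteGaloisGroup k
  obtain ⟨f, hf, hfσ⟩ := exists_reduceTorsionHom hpv hgood h𝔐 ι hσL hφk
  set σ₀ : absoluteGaloisGroup ℚ := resGalOfEmb ι σL with hσ₀
  -- Step 2: Manin's relation pulled back along `f`: `σ₀²P − a_ℓ σ₀P + ℓP = O` on `E[p^∞]`
  have hrel : ∀ (P : geomPoints W) (n : ℕ), p ^ n • P = 0 →
      σ₀ • (σ₀ • P) - W.frobeniusTrace ℓ • (σ₀ • P) + (ℓ : ℤ) • P = 0 := by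
    intro P n hP
    obtain ⟨P', hP'⟩ : ∃ P' : geomPrimaryTorsion W p, (P' : geomPoints W) = P := ⟨⟨P, n, hP⟩, rfl⟩
    have hmanin := Wt.frobenius_sq_sub_trace_smul_add_card_smul hφk (f P')
    rw [htr, hcardk, ← hfσ, ← hfσ, ← map_zsmul, ← map_zsmul, ← map_sub, ← map_add, ← f.map_zero] at hmanin
    have hrel' : σ₀ • (σ₀ • P') - W.frobeniusTrace ℓ • (σ₀ • P') + (ℓ : ℤ) • P' = 0 := hf hmanin
    have h := congrArg Subtype.val hrel'
    simp only [AddSubgroupClass.coe_sub, AddMemClass.coe_add, primaryComponent.coe_smul, ZeroMemClass.coe_zero, hP'] at h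
    exact h
  -- scalars divisible by `p` kill `E[p]`
  have hpfix : ∀ y : geomPoints W, p • y = 0 → ∀ z : ℤ, (p : ℤ) ∣ z → z • y = 0 := by
    rintro y hy z ⟨c, rfl⟩
    rw [mul_comm, mul_zsmul, natCast_zsmul, hy, zsmul_zero]
  -- (A) on `E[p]`: `(σ₀ − 1)² = 0`, i.e. `σ₀ (σ₀ y − y) = σ₀ y − y`
  have hA : ∀ y : geomPoints W, p • y = 0 → σ₀ • (σ₀ • y - y) = σ₀ • y - y := by
    intro y hy
    have hσy : p • (σ₀ • y) = 0 := by rw [smul_comm, hy, smul_zero]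
    have h2 : W.frobeniusTrace ℓ • (σ₀ • y) = (2 : ℤ) • (σ₀ • y) := by
      have h := hpfix _ hσy _ ha2
      rwa [sub_smul, sub_eq_zero] at h
    have h3 : (ℓ : ℤ) • y = y := by
      have h := hpfix y hy _ hℓ1
      rwa [sub_smul, one_smul, sub_eq_zero] at h
    have h1 := hrel y 1 (by rwa [pow_one])
    rw [h2, h3, two_zsmul] at h1
    have h4 : σ₀ • (σ₀ • y) - σ₀ • y - (σ₀ • y - y) = σ₀ • (σ₀ • y) - (σ₀ • y + σ₀ • y) + y := by abel
    rw [smul_sub, ← sub_eq_zero, h4, h1]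
  -- (B) `σ₀` moves some point of `E[p]` (else a point of order `p²` forces `p² ∣ ℓ + 1 − a_ℓ`)
  obtain ⟨e, Φ, he, -, -, -, -⟩ := exists_frame_galoisRepTorsion_rat W p
  have hB : ∃ y : geomPoints W, p • y = 0 ∧ σ₀ • y ≠ y := by
    by_contra hnone
    push Not at hnone
    obtain ⟨w, hw⟩ := exists_ne (0 : Fin 2 → ZMod p)
    have hx0 : e.symm w ≠ 0 := fun h ↦ hw (by simpa using congrArg e h)
    have hxp : p • (e.symm w : geomPoints W) = 0 := by
      have h := (mem_torsionPoints_iff _ _ (e.symm w : geomPoints W)).mp (e.symm w).2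
      rwa [natCast_zsmul] at h
    obtain ⟨P, hP⟩ := W.zsmul_geomPoints_surjective_of_charZero (n := (p : ℤ)) (by exact_mod_cast hp.ne_zero)
      (e.symm w : geomPoints W)
    have hPp : p • P = (e.symm w : geomPoints W) := by rw [← natCast_zsmul]; exact hP
    have hP2 : p ^ 2 • P = 0 := by rw [pow_two, mul_nsmul, hPp, hxp]
    set Q : geomPoints W := σ₀ • P - P with hQ
    have hQp : p • Q = 0 := by rw [hQ, nsmul_sub, smul_comm p σ₀ P, hPp, hnone _ hxp, sub_self]
    have hσQ : σ₀ • Q = Q := hnone Q hQp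
    have hσP : σ₀ • P = P + Q := by rw [hQ]; abel
    have hσσP : σ₀ • (σ₀ • P) = P + (2 : ℤ) • Q := by rw [hσP, smul_add, hσQ, hσP, two_zsmul]; abel
    have haQ : W.frobeniusTrace ℓ • Q = (2 : ℤ) • Q := by
      have h := hpfix Q hQp _ ha2
      rwa [sub_smul, sub_eq_zero] at h
    have hM := hrel P 2 hP2
    rw [hσσP, hσP, smul_add, haQ] at hM
    have hord : ((ℓ : ℤ) + 1 - W.frobeniusTrace ℓ) • P = 0 := by
      have h : ((ℓ : ℤ) + 1 - W.frobeniusTrace ℓ) • P =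
          P + (2 : ℤ) • Q - (W.frobeniusTrace ℓ • P + (2 : ℤ) • Q) + (ℓ : ℤ) • P := by
        rw [sub_zsmul, add_zsmul, one_zsmul]; abel
      rw [h, hM]
    have hordP : addOrderOf P = p ^ 2 := by
      obtain ⟨j, hj, hjP⟩ := (Nat.dvd_prime_pow hp).mp (addOrderOf_dvd_of_nsmul_eq_zero hP2)
      interval_cases j
      · exfalso; apply hx0
        rw [pow_zero, AddMonoid.addOrderOf_eq_one_iff] at hjP
        exact Subtype.ext (by rw [← hPp, hjP, smul_zero, ZeroMemClass.coe_zero])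
      · exfalso; apply hx0
        have h1 : p • P = 0 := by simpa [hjP] using addOrderOf_nsmul_eq_zero P
        exact Subtype.ext (by rw [← hPp, h1, ZeroMemClass.coe_zero])
      · exact hjP
    have hdvd : ((p ^ 2 : ℕ) : ℤ) ∣ (ℓ : ℤ) + 1 - W.frobeniusTrace ℓ := by
      rw [← hordP]; exact addOrderOf_dvd_iff_zsmul_eq_zero.mpr hord
    exact hp2 (by exact_mod_cast hdvd)
  -- (C) `g = ρ̄(σ₀)`: `g ^ p = 1` (from `σ₀ⁿ y = y + n (σ₀ y − y)` on `E[p]`), `g ≠ 1`, so `p ∣ #ρ̄(Γ_ℚ)` — Serre Prop. 15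
  have hpow : ∀ y : geomPoints W, p • y = 0 → ∀ n : ℕ, σ₀ ^ n • y = y + n • (σ₀ • y - y) := by
    intro y hy n
    induction n with
    | zero => rw [pow_zero, one_smul, zero_smul, add_zero]
    | succ n ih =>
        rw [pow_succ', mul_smul, ih, smul_add, smul_comm σ₀ n (σ₀ • y - y), hA y hy, succ_nsmul]
        abel
  have hgp : galoisRepTorsion W p σ₀ ^ p = 1 := by
    rw [← map_pow]
    refine Multiplicative.toAdd.injective (AddEquiv.ext fun P ↦ ?_)
    rw [galoisRepTorsion_apply]
    have hPp : p • (P : geomPoints W) = 0 := by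
      have h := (mem_torsionPoints_iff _ _ (P : geomPoints W)).mp P.2
      rwa [natCast_zsmul] at h
    apply Subtype.ext
    rw [AddSubgroup.torsionBy.coe_smul, hpow _ hPp p, nsmul_sub, smul_comm p σ₀ (P : geomPoints W), hPp, smul_zero,
      sub_self, add_zero]
    rfl
  have hg1 : galoisRepTorsion W p σ₀ ≠ 1 := by
    intro h1
    obtain ⟨y, hy, hσy⟩ := hB
    have hyp : ((p : ℕ) : ℤ) • y = 0 := by rw [natCast_zsmul]; exact hy
    have h := galoisRepTorsion_apply W p σ₀ ⟨y, (mem_torsionPoints_iff _ _ _).mpr hyp⟩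
    rw [h1] at h
    exact hσy (congrArg Subtype.val h).symm
  set G : Subgroup (GL (Fin 2) (ZMod p)) := (galoisRepTorsion W p).range.map Φ.toMonoidHom with hG
  have hGtop : G ≠ ⊤ := fun h ↦ hns ((map_range_galoisRepTorsion_eq_top_iff W p Φ).mp h)
  have hdetG : ∀ u : (ZMod p)ˣ, ∃ g ∈ G, Matrix.GeneralLinearGroup.det g = u := exists_mem_map_range_det_eq W p Φ e he
  have hirrG : ∀ (u : Fin 2 → ZMod p) (hu : u ≠ 0), ¬ G ≤ eigenvectorStabilizer u hu :=
    fun u hu ↦ not_le_eigenvectorStabilizer_of_hasIrreducibleModPGaloisRep W p Φ e he hirr hu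
  have hcard : ¬ p ∣ Nat.card G := Serre1972.not_dvd_natCard_of_forall_not_le_eigenvectorStabilizer G hdetG hGtop hirrG
  have horder : orderOf (Φ (galoisRepTorsion W p σ₀)) = p := by
    refine orderOf_eq_prime ?_ fun h ↦ hg1 (Φ.injective (h.trans (map_one Φ).symm))
    rw [← map_pow, hgp, map_one]
  have hdvdG := Subgroup.orderOf_dvd_natCard G (apply_galoisRepTorsion_mem_map_range W p Φ σ₀)
  rw [horder] at hdvdG
  exact hcard hdvdG

end Summit.BirchSwinnertonDyer.BirchSwinnertonDyer.Rank2Observatory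

end
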